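import Summits.ABC.IUTFork.Repair.CandInternal2Real
import Summits.ABC.IUTFork.Conditional.AbcOfSRealisingQObstruction
import Summits.ABC.IUTFork.Repair.RHHeightClass
import HarnessLib

/-!
# R-H ROUND 1 (D-0107), ROW 8 — TESTER's k2 SCOPE LEMMAS (abc-iut-rh-tst-8): the unramified-odd refutation family has NO INSTANCE
# on row 8 — neither on the superseded reading «datum-class-H-lt-4» (`Repair/RHDatumClassHLt4.lean`, p457793) nor on the row of
# record «heightclass» `Repair.RHHeightClass.HBand` / `.H` (p459046), which are FALSE at every datum with an unramified bad place

PROOF-ONLY file (0 definitions, 0 `Prop` facts) of the abc-iut cell, R-H tester seat abc-iut-rh-tst-8 (gen 0; pair n = 8 with typer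
abc-iut-rh-typ-8; lead abc-iut-rh-lead g0), test k2 of plan/rescue/R-H/RH-CANDIDATES.tsv row 8. TAKES NO SIDE on [IUTchIII] Cor. 3.12 or
on any author (Mochizuki / Scholze–Stix / Joshi / Dupuy–Hilado); candidates are hypotheses; typed ≠ proved; nothing here asserts abc.

QUESTION (director 15:32:46Z, k2): does H⋆₈ survive the unramified-odd refutation family that killed RP-I06⋆ as typed —
`Repair.CandInternal2Real.not_mem_jsq_smul_logShell_of_unramified` (p432650), `Repair.EvalHonestCeiling.i06_false_of_honest` (p433150),
`Cor312Vol.LicenceSharpDegreeOne.not_licence_settingPrVolSharp_rat` / `not_pilotKummerCompatHull_settingPrVolSharp_rat_of_qPinned`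
(w5-d204 p438525), `Thm311.Real.not_licence_settingPrVolSharp_of_realising` (C-cert-2 p433074),
`Repair.CandInternal2RealBed.class_false_settingPrVolSharp_of_realising`?

ANSWER (kernel, this file): every member of that family MISSES row 8, because its SUBJECT does not exist where row 8 speaks.
* §1 CELL LEVEL (reading «class H(v) < 4 ⇒ I06⋆», typ-8's `RH.DatumClassHLt4.HStarI06OfHeightLt 4`). The I06⋆ cell's Kummer datum is the
  `2l`-th ROOT `q̲_w ∈ K_w` of the q-parameter (I06STAR-COLUMNS «UNITS»; [IUTchII] p. 2). In an ABSOLUTELY UNRAMIFIED `K_w` the value group is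
  `p^ℤ` (`norm_eq_rpow_neg_int_of_unramified`), so `‖q̲‖^{N} = p^{−H}` forces `N ∣ H` (`natCast_dvd_of_norm_pow_eq_of_unramified`); with
  `N = 2l ≥ 10 > 4 > H > 0` impossible (`no_twoL_root_of_unramified_of_lt_four`). AS TYPED (real `0 ≤ H < 4`): only `H = 0` is realised at
  `e_w = 1`, `q̲` is a unit, and every label cell HOLDS (`cell_mem_of_unramified_odd_of_height_lt`; `hStarI06OfHeightLt_four_on_unramified_odd`
  = typ-8's binders restricted to `absRamificationIdx p K = 1 ∧ p ≠ 2`, PROVED).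
* §2 GLUE LEVEL (reading «class ⇒ licence»). Every licence-level member carries `q`-ideles REALISING `P_q` (Dupuy–Hilado (3.4)); C-cert-3's
  `Thm311.Real.two_mul_l_dvd_ordq_of_realising` (w5-d054 p432578) forces `2l ∣ ord_v(q_v)` on `S`, impossible when `ord_v(q_v) < 2l`
  (`no_realising_qIdeles_of_ordq_lt`), in particular at an unramified bad place of a class datum, `ord_v(q_v) = H(v) < 4`
  (`no_realising_qIdeles_of_class_at_unramified`): those members range over an EMPTY parameter space there.
* §3 ROW OF RECORD «heightclass» (`RHHeightClass.HBand`, `.H`, p459046). At a bad place `x | p` with `e(x|p) = 1` the certified valuation is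
  forced to `r = 1` (`certVal_one`: the strict minimum of `p^t − t` is `1` at `t = 0`), so the `j = 2` band reads `3·m_q(x) ≤ 0` against
  `m_q(x) = ord_x(q)/(2l) > 0` (`hBand_false_of_unramified_bad_place`); for `.H` the donor rate is forced to `g ≤ 1 − r/e = 0` and the `j = 2`
  class cell reads `4m_q − 1 ≤ m_q − 1 + 2g` (`h_false_of_unramified_bad_place`). So `HBand X` and `H X` are FALSE at every datum with an
  absolutely unramified bad place: «H⋆₈ ⟹ S_H» is VACUOUS on that stratum, no unramified-odd lemma can kill it, and H⋆₈ rescues nothing there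
  (consistent with RP-I06⋆ NEG at such places, p432650).
HONEST SCOPE. A k2 PASS-BY-SCOPE for the unramified-odd family ONLY; it says nothing in favour of row 8. The superseded reading (a) is
refuted on deeply ramified cells by the DEEP family (typ-8's `RH.DatumClassHLt4.cell_7_11_22_2_25_not_mem`, conditional on an inhabitant;
`CandInternal2RealStrata.not_mem_pow_smul_logShell_of_root_lt` p451037 at I06STAR-COLUMNS rows G-HEX-k1-l17-ev15@p7.j8, G-HEX-k1-l19-ev15/ev30)
— a k1 matter of record, not this file's. [cite: DupuyHilado2025, §3.3, §3.4] [cite: MochizukiAbsTopIII2015, Def 5.4 (iii) p. 126]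
-/

noncomputable section

open Set Function Metric NumberField IsDedekindDomain
open scoped Pointwise

namespace Summit.ABC.IUTFork.Repair.RHHeightClassUnramOdd

open Literature.AnabelianGeometry.AbsoluteAnabelian Literature.IUT.LogThetaLattice Literature.IUT.LogVolume
  Literature.NumberTheory.NumberFields Cor312 Cor312Vol Thm311.Real

/-! ## 1. Cell level: no `2l`-th root datum of height `0 < H < 2l` in an absolutely unramified `K_w` -/

section Cell

variable (p : ℕ) [Fact p.Prime]
variable (K : Type*) [NontriviallyNormedField K] [NormedAlgebra ℚ_[p] K] [IsUltrametricDist K] [ProperSpace K]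

/-- In an absolutely unramified `K/ℚ_p` (`e = 1`) every nonzero element has norm an INTEGER power of `p`: `‖x‖ = p^{−m}`, `m ∈ ℤ`
(abc-iut-S1 `exists_norm_eq_rpow` with `e = 1`). [cite: MochizukiAbsTopIII2015, Def 5.4 (iii) p. 126] -/
theorem norm_eq_rpow_neg_int_of_unramified (he : absRamificationIdx p K = 1) {x : K} (hx : x ≠ 0) :
    ∃ m : ℤ, ‖x‖ = (p : ℝ) ^ (-(m : ℝ)) := by
  obtain ⟨m, hm⟩ := exists_norm_eq_rpow p K hx
  refine ⟨m, ?_⟩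
  rw [hm, he, Nat.cast_one, div_one]

/-- **Value-group obstruction.** If `e = 1` and `‖q̲‖^N = p^{−H}` (`H ∈ ℤ`) for a nonzero `q̲`, then `N ∣ H`.
[cite: MochizukiAbsTopIII2015, Def 5.4 (iii) p. 126] -/
theorem natCast_dvd_of_norm_pow_eq_of_unramified (he : absRamificationIdx p K = 1) {q : K} (hq : q ≠ 0) {N : ℕ} {H : ℤ}
    (h : ‖q‖ ^ N = (p : ℝ) ^ (-(H : ℝ))) : (N : ℤ) ∣ H := by
  obtain ⟨m, hm⟩ := norm_eq_rpow_neg_int_of_unramified p K he hq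
  have hp0 : (0 : ℝ) < p := by exact_mod_cast (Fact.out : p.Prime).pos
  have hp1 : (p : ℝ) ≠ 1 := by exact_mod_cast (Fact.out : p.Prime).one_lt.ne'
  rw [hm, ← Real.rpow_natCast, ← Real.rpow_mul hp0.le, Real.rpow_right_inj hp0 hp1] at h
  -- `-(m) * N = -H` in `ℝ`, hence `m * N = H` in `ℤ`
  have hZ : (m * N : ℤ) = H := by
    have h' : ((m * N : ℤ) : ℝ) = ((H : ℤ) : ℝ) := by push_cast; linarith
    exact_mod_cast h'
  exact ⟨m, by rw [← hZ, mul_comm]⟩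

/-- **No root datum in the unramified stratum below the root order.** `e = 1`, `q̲ ≠ 0`, `‖q̲‖^N = p^{−H}` with `0 < H < N` is
impossible. [cite: MochizukiAbsTopIII2015, Def 5.4 (iii) p. 126] -/
theorem no_root_of_unramified_of_lt (he : absRamificationIdx p K = 1) {q : K} (hq : q ≠ 0) {N H : ℕ} (hH0 : 0 < H) (hHN : H < N)
    (h : ‖q‖ ^ N = (p : ℝ) ^ (-(H : ℝ))) : False := by
  have hdvd : (N : ℤ) ∣ (H : ℤ) :=
    natCast_dvd_of_norm_pow_eq_of_unramified p K he hq (H := (H : ℤ)) (by exact_mod_cast h)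
  have hdvd' : N ∣ H := by exact_mod_cast hdvd
  exact absurd (Nat.le_of_dvd hH0 hdvd') (not_le.2 hHN)

/-- **ROW 8, cell level.** Inside the class `H < 4` (with `0 < H`, a bad place) NO absolutely unramified `K_w` contains the I06⋆ cell's
subject `q̲_w` (`‖q̲_w‖^{2l} = p^{−H}`), for every admissible `l ≥ 5`: the unramified(-odd) cell lemma
`CandInternal2Real.not_mem_jsq_smul_logShell_of_unramified` has no instance at the Kummer root there.
[cite: MochizukiAbsTopIII2015, Def 5.4 (iii) p. 126] -/
theorem no_twoL_root_of_unramified_of_lt_four (he : absRamificationIdx p K = 1) {l : ℕ} (hl : 5 ≤ l) {H : ℕ} (hH0 : 0 < H)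
    (hH4 : H < 4) {q : K} (hq : q ≠ 0) (h : ‖q‖ ^ (2 * l) = (p : ℝ) ^ (-(H : ℝ))) : False :=
  no_root_of_unramified_of_lt p K he hq hH0 (by omega) h

-- CONTRAST (record, no restatement — gate dedup): at an absolutely unramified odd place the UN-ROOTED parameter `q_v` (`‖q_v‖ < 1`)
-- satisfies `q_v ∉ q_v^{j²}·𝓘` for every `j ≥ 2` — this is EXACTLY abc-iut-rp-d2's landed
-- `Summit.ABC.IUTFork.Repair.CandInternal2Real.not_mem_jsq_smul_logShell_of_unramified` (p432650), cited BY NAME; it is NOT the I06⋆ cell of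
-- record (whose subject is the root `q̲`). [proxy-filer's edit for abc-iut-rh-tst-8: the verbatim restatement was removed at the gate's request]

/-- **The unramified-odd stratum of typ-8's `RH.DatumClassHLt4.HStarI06OfHeightLt 4` (p457793) HOLDS — so that family cannot kill it.**
As typed, H⋆₈(a) binds a REAL height `0 ≤ H < 4` and `q̲ ≠ 0` with `‖q̲‖^{N} = p^{−H}` (`N = 2l ≥ 10`); at `e = 1` the value group `p^ℤ` forces
`H = m·N` with `m ∈ ℤ`, and `0 ≤ m·N < 4 ≤ N` forces `m = 0`: `q̲` is a UNIT, and a unit lies in `q̲^{n}·ℐ_K = q̲^{n}·𝒪_K` for every `n`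
(`p ≠ 2`: `ℐ_K = 𝒪_K`, abc-iut-L6). Binder shape = typ-8's, restricted to `absRamificationIdx p K = 1 ∧ p ≠ 2`; stated without importing the
pending file. [cite: MochizukiAbsTopIII2015, Def 5.4 (iii) p. 126] -/
theorem cell_mem_of_unramified_odd_of_height_lt (hp : p ≠ 2) (he : absRamificationIdx p K = 1) {q : K} (hq : q ≠ 0) {N : ℕ} (hN : 4 ≤ N)
    {H : ℝ} (hH0 : 0 ≤ H) (hH4 : H < 4) (h : ‖q‖ ^ N = (p : ℝ) ^ (-H)) (n : ℕ) :
    q ∈ q ^ n • logShell (PadicLogOnUnits.ofUnitLog p K) := by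
  obtain ⟨m, hm⟩ := norm_eq_rpow_neg_int_of_unramified p K he hq
  have hp0 : (0 : ℝ) < p := by exact_mod_cast (Fact.out : p.Prime).pos
  have hp1 : (p : ℝ) ≠ 1 := by exact_mod_cast (Fact.out : p.Prime).one_lt.ne'
  rw [hm, ← Real.rpow_natCast, ← Real.rpow_mul hp0.le, Real.rpow_right_inj hp0 hp1] at h
  -- `H = m·N` with `0 ≤ m·N < 4 ≤ N`, so `m = 0`
  have hHN : H = (m : ℝ) * (N : ℝ) := by linarith
  have hN' : (4 : ℝ) ≤ (N : ℝ) := by exact_mod_cast hN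
  have hm0 : m = 0 := by
    rcases lt_trichotomy m 0 with hlt | heq | hgt
    · have : (m : ℝ) ≤ -1 := by exact_mod_cast (Int.le_sub_one_of_lt hlt)
      nlinarith
    · exact heq
    · have : (1 : ℝ) ≤ (m : ℝ) := by exact_mod_cast hgt
      nlinarith
  have hunit : ‖q‖ = 1 := by rw [hm, hm0]; simp
  rw [logShell_ofUnitLog_eq_closedBall_of_unramified p K hp he]
  have hqn : q ^ n ≠ 0 := pow_ne_zero n hq
  refine Set.mem_smul_set.2 ⟨(q ^ n)⁻¹ * q, ?_, ?_⟩
  · rw [mem_closedBall, dist_zero_right, norm_mul, norm_inv, norm_pow, hunit]; simp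
  · rw [smul_eq_mul, ← mul_assoc, mul_inv_cancel₀ hqn, one_mul]

/-- **k2 VERDICT FOR p457793, kernel form: `HStarI06OfHeightLt 4` restricted to the unramified-odd stratum is TRUE** (same binders as typ-8's
def, plus `p ≠ 2`, `absRamificationIdx p K = 1`): every label cell holds there, because the only realised height below `4` is `H = 0`.
[cite: MochizukiAbsTopIII2015, Def 5.4 (iii) p. 126] -/
theorem hStarI06OfHeightLt_four_on_unramified_odd (hp : p ≠ 2) (he : absRamificationIdx p K = 1) (k : ℕ) (_h5 : 5 ≤ 2 * k + 1)
    (H : ℝ) (hH0 : 0 ≤ H) (hH4 : H < 4) (q : K) (hq : q ≠ 0) (hqN : ‖q‖ ^ (2 * (2 * k + 1)) = (p : ℝ) ^ (-H)) :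
    ∀ j ≤ k, q ∈ q ^ (j ^ 2) • logShell (PadicLogOnUnits.ofUnitLog p K) :=
  fun j _ => cell_mem_of_unramified_odd_of_height_lt p K hp he hq (by omega) hH0 hH4 hqN (j ^ 2)

end Cell

/-! ## 2. Glue level: no realising `q`-ideles when `ord_v(q_v) < 2l` at a bad place -/

section Glue

variable {F : Type} [Field F] [NumberField F] (X : PilotData F)

/-- **No realising `q`-ideles below the root order.** If `ord_v(q_v) < 2l` at some bad place `v ∈ S`, NO family of `q`-ideles
satisfies Dupuy–Hilado's normalisation (3.4) (C-cert-3 `Thm311.Real.two_mul_l_dvd_ordq_of_realising`, `Conditional/AbcOfSRealisingQObstruction`: realising forces `2l ∣ ord_v(q_v)`).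
Hence every settingPrVolSharp-level refutation carrying such a family (`not_licence_settingPrVolSharp_rat`, `…_of_realising`, …) has an
empty parameter space at such a datum. [cite: DupuyHilado2025, §3.3, §3.4] -/
theorem no_realising_qIdeles_of_ordq_lt {v : HeightOneSpectrum (𝓞 F)} (hv : v ∈ X.S) (hlt : X.ordq v < 2 * X.l)
    (tq : ∀ (pp : Nat.Primes) (x : (thetaIndex X).Fibre (.inr pp)), haveI : Fact (pp : ℕ).Prime := ⟨pp.2⟩; kOf X pp.1 x)
    (htq : ∀ (pp : Nat.Primes) (x : (thetaIndex X).Fibre (.inr pp)),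
      haveI : Fact (pp : ℕ).Prime := ⟨pp.2⟩
      Real.log ‖tq pp x‖ = -(X.qPilot (placeOf X pp.1 x)) * logNorm F (placeOf X pp.1 x) /
        localDegree F (placeOf X pp.1 x)) : False := by
  have hdvd : (2 * X.l : ℤ) ∣ X.ordq v := Thm311.Real.two_mul_l_dvd_ordq_of_realising X tq htq hv
  exact absurd (Int.le_of_dvd (X.ordq_pos hv) hdvd) (not_le.2 (by exact_mod_cast hlt))

/-- **ROW 8, glue level.** At an ABSOLUTELY UNRAMIFIED bad place `v` (`e(v|p) = 1`) of a pilot datum in the class «`H(v) =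
ord_v(q_v)/e(v|p) < 4`», no realising `q`-idele family exists (`ord_v(q_v) = H(v) < 4 < 10 ≤ 2l`, `l ≥ 5` by [IUTchI] Def. 3.1 (c)):
the glue-level unramified-odd family (w5-d204 p438525, C-cert-2 p433074, `class_false_settingPrVolSharp_of_realising`) misses H⋆_8.
[cite: DupuyHilado2025, §3.3, §3.4] -/
theorem no_realising_qIdeles_of_class_at_unramified {v : HeightOneSpectrum (𝓞 F)} (hv : v ∈ X.S)
    (hclass : (X.ordq v : ℝ) / (ramIdx F v : ℝ) < 4) (he : ramIdx F v = 1)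
    (tq : ∀ (pp : Nat.Primes) (x : (thetaIndex X).Fibre (.inr pp)), haveI : Fact (pp : ℕ).Prime := ⟨pp.2⟩; kOf X pp.1 x)
    (htq : ∀ (pp : Nat.Primes) (x : (thetaIndex X).Fibre (.inr pp)),
      haveI : Fact (pp : ℕ).Prime := ⟨pp.2⟩
      Real.log ‖tq pp x‖ = -(X.qPilot (placeOf X pp.1 x)) * logNorm F (placeOf X pp.1 x) /
        localDegree F (placeOf X pp.1 x)) : False := by
  have h4 : (X.ordq v : ℝ) < 4 := by simpa [he] using hclass
  have h4' : X.ordq v < 4 := by exact_mod_cast h4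
  have hl : (5 : ℤ) ≤ X.l := by exact_mod_cast X.five_le_l
  exact no_realising_qIdeles_of_ordq_lt X hv (by omega) tq htq

end Glue

/-! ## 3. The row of record «heightclass» (`Repair.RHHeightClass.HBand` / `.H`, p459046; author abc-iut-lens-strengthen-1, typer
abc-iut-rh-typ-8): FALSE at every datum with an absolutely unramified bad place — the unramified-odd family cannot bite «H⋆₈ ⟹ ·» -/

section HeightClass

open RHHeightClass

variable {F : Type} [Field F] [NumberField F] (X : PilotData F)

/-- At ramification index `e = 1` the certified member valuation is `r = 1` (the strict minimum of `p^t − t` over `t ∈ ℕ` is `1`, at `t = 0`,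
for every `p ≥ 2`; the fallback is `r = e = 1`). [folklore] -/
theorem certVal_one {p : ℕ} (hp : 2 ≤ p) {r : ℤ} (h : CertVal p 1 r) : r = 1 := by
  rcases h with ⟨t, ht, hmin⟩ | h
  · by_cases h0 : t = 0
    · subst h0; simpa using ht.symm
    · -- `t ≥ 1`: the competitor `t' = 0` gives `r < 1`, while `r = p^t − t ≥ 1`
      have hlt : r < 1 := by simpa using hmin 0 (Ne.symm h0)
      have hge : (t : ℤ) + 1 ≤ (p : ℤ) ^ t := by
        have h2t : t + 1 ≤ 2 ^ t := Nat.lt_two_pow_self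
        have hpt : 2 ^ t ≤ p ^ t := Nat.pow_le_pow_left hp t
        exact_mod_cast h2t.trans hpt
      have : (1 : ℤ) ≤ r := by rw [← ht]; push_cast; linarith
      exact absurd hlt (not_lt.2 this)
  · simpa using h

/-- **ROW 8 «heightclass», k2 (band form).** `HBand X` FAILS at every pilot datum with an ABSOLUTELY UNRAMIFIED bad place `x` (`e(x|p) = 1`):
there the certified valuation is `r = 1`, so the band at the label `j = 2` (which exists, `l⋆ ≥ 2`) reads `3·m_q(x) ≤ 2·(1 − 1) + (1 − 1) = 0`,
against `m_q(x) = ord_x(q)/(2l) > 0`. Hence «HBand ⟹ S_H» is VACUOUS on the unramified(-odd) stratum and no member of the unramified-odd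
refutation family can kill it; equally, HBand rescues nothing there (consistent with RP-I06⋆ NEG at such places, p432650). [cite: DupuyHilado2025, §3.3] -/
theorem hBand_false_of_unramified_bad_place {pp : Nat.Primes} {x : (thetaIndex X).Fibre (.inr pp)}
    (hx : haveI : Fact (pp : ℕ).Prime := ⟨pp.2⟩; placeOf X pp.1 x ∈ X.S)
    (he : haveI : Fact (pp : ℕ).Prime := ⟨pp.2⟩; ramIdx F (placeOf X pp.1 x) = 1) : ¬ HBand X := by
  haveI : Fact (pp : ℕ).Prime := ⟨pp.2⟩
  intro h
  obtain ⟨hp2, -, r, hcert, hband⟩ := h pp ⟨1, X.two_le_lstar⟩ x hx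
  rw [he] at hcert hband
  have hr : r = 1 := certVal_one (by have := pp.2.two_le; omega) hcert
  subst hr
  have hq : 0 < X.qPilot (placeOf X pp.1 x) := by
    rw [X.qPilot_apply_of_mem hx]
    exact div_pos (by exact_mod_cast X.ordq_pos hx) X.two_mul_l_pos
  norm_num at hband
  linarith

/-- **ROW 8 «heightclass», k2 (general-fibre form `H`).** `H X` FAILS at every pilot datum with an absolutely unramified bad place `x | p`:
`CertVal p 1 r` forces `r = 1` at `x`, so the donor rate satisfies `g ≤ 1 − r/e = 0`, and the class cell at `j = 2`,
`(4·m_q − 1)/1 ≤ (m_q − 1)/1 + 2·g`, forces `3·m_q ≤ 2g ≤ 0` against `m_q > 0`. [cite: DupuyHilado2025, §3.3] -/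
theorem h_false_of_unramified_bad_place {pp : Nat.Primes} {x : (thetaIndex X).Fibre (.inr pp)}
    (hx : haveI : Fact (pp : ℕ).Prime := ⟨pp.2⟩; placeOf X pp.1 x ∈ X.S)
    (he : haveI : Fact (pp : ℕ).Prime := ⟨pp.2⟩; ramIdx F (placeOf X pp.1 x) = 1) : ¬ H X := by
  haveI : Fact (pp : ℕ).Prime := ⟨pp.2⟩
  intro h
  obtain ⟨hp2, g, hcert, hcell⟩ := h pp ⟨x, hx⟩
  have hp : 2 ≤ (pp : ℕ) := by have := pp.2.two_le; omega
  -- the donor rate is `≤ 0`, certified at `x` itself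
  obtain ⟨r, hr, hg⟩ := hcert x
  rw [he] at hr hg
  obtain rfl := certVal_one hp hr
  have hg0 : g ≤ 0 := by simpa using hg
  -- the class cell at `j = 2`
  obtain ⟨r', hr', hc⟩ := hcell ⟨1, X.two_le_lstar⟩ x hx
  rw [he] at hr' hc
  obtain rfl := certVal_one hp hr'
  have hq : 0 < X.qPilot (placeOf X pp.1 x) := by
    rw [X.qPilot_apply_of_mem hx]
    exact div_pos (by exact_mod_cast X.ordq_pos hx) X.two_mul_l_pos
  simp only [ClassCell] at hc
  norm_num at hc
  linarith

end HeightClass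

end Summit.ABC.IUTFork.Repair.RHHeightClassUnramOdd
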